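import Summits.Parity.GeneralizedHardyLittlewood.Theorems.BeyondDiagonalBeatsQuarter.OffDiagLevelFactorBox
import HarnessLib

/-!
# Route `PrimeLevelFamEdge`, crux K_B (stmt-Parity-20343), line `diagonal_kernel_split` rev 4, plan Ω,
# node **L7c, part 6 — the level-factor form AT A SWITCHED CELL** (bridge from `OffDiagCoreSplit.switchedCell`'s literal
# dual point `(h₁/(q(r+1)), s/h₁ + A/(h₁·q(r+1)))` to the `(X₁/q, σ + X₂/q)` form of `OffDiagLevelFactorForm`)

In `OffDiagCoreSplit` (prover-6) the innermost term of a switched cell at level `q` is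
`K(q) · Φ̂_{q,d,l/d₁,m/d₂,r+1,i}(h₁/(q(r+1)), s/h₁ + A/(h₁·q(r+1)))`, `A = (l/d₁)(m/d₂)`. With `X₁ = h₁/(r+1)`, `σ = s/h₁`,
`X₂ = A/(h₁(r+1))` this is the dual point `(X₁/q, σ + X₂/q)` of `OffDiagLevelFactorForm`, so after the consumer has made
the level sum innermost (`OffDiagCoreRanges.coreL_eq_enlarged`, prover-7) every cell is a finite level sum
`Σ_{q∈S} c_q·Φ̂_{q,…}(…)` to which `sum_mul_fourier2_boxWeight_eq` and then `levelFactor_separation_box` apply: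

* `dualPoint_fst_eq`, `dualPoint_snd_eq` — the two argument rewrites;
* `fourier2_boxWeight_cell_eq` — `Φ̂_{q}(h₁/(q(r+1)), s/h₁ + A/(h₁q(r+1))) = Φ̂_{q}(X₁·q⁻¹, σ + X₂·q⁻¹)`;
* **`sum_mul_fourier2_boxWeight_cell_eq`** — for a finite set `S` of levels `q ≥ 1`, divisors `d₁ ∣ l`, `d₂ ∣ m` of
  `l, m ≥ 1`, any Petersson index `r`, box `i`, switched pair `(h₁, s)` and ANY complex level weights `c_q` (kernel ×
  prefactors): `Σ_{q∈S} c_q·Φ̂_{q,d₁,d₂,l/d₁,m/d₂,r+1,i}(h₁/(q(r+1)), s/h₁ + A/(h₁q(r+1))) = ∫dt₁∫dt₂ K(t)·Σ_{q∈S} c_q·Ψ_t(1/q)`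
  with the `q`-free weight `K(t) = θθ·(d₁t₁d₂t₂)^{−1/2}(r+1)⁻¹·e(−t₂ s/h₁)` and the level factor
  `Ψ_t(v) = W(4π²d₁t₁d₂t₂·v)·J₁((4π√((l/d₁)t₁(m/d₂)t₂)/(r+1))·v)·e(−(t₁h₁/(r+1) + t₂A/(h₁(r+1)))·v)`.

Exact identities; helper; closes nothing; standard axioms. «The programme SEARCHES and TYPES; no claim about Landau–Siegel
zeros, Theorems 1–2 of arXiv:2211.02515 or a repaired Margin232 until a kernel theorem says so.»
-/

noncomputable section

open Finset Real Complex MeasureTheory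
open scoped Nat

namespace Summit.Parity.GeneralizedHardyLittlewood.Theorems.BeyondDiagonalBeatsQuarter.LevelSeparation

open Literature.Analysis.FunctionSpaces (besselJ)
open Literature.Analysis.Calculus.WhitneyConvex (dyadicBump)
open Literature.NumberTheory.LFunctions.KMV2000 (cutoffW)
open Literature.NumberTheory.Sieve.FriedlanderIwaniecPrimes (fourier2 ker)
open OffDiag (boxWeight)

/-- The first dual argument: `h₁/(q(r+1)) = (h₁/(r+1))·q⁻¹`. [folklore] -/
theorem dualPoint_fst_eq (q r : ℕ) (h₁ : ℤ) :
    ((h₁ : ℝ) / ((q * (r + 1) : ℕ) : ℝ)) = ((h₁ : ℝ) / (r + 1)) * ((q : ℝ))⁻¹ := by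
  rw [Nat.cast_mul, Nat.cast_succ, mul_comm (q : ℝ), ← div_div, div_eq_mul_inv _ (q : ℝ)]

/-- The second dual argument: `s/h₁ + A/(h₁·q(r+1)) = s/h₁ + (A/(h₁(r+1)))·q⁻¹`. [folklore] -/
theorem dualPoint_snd_eq (q r : ℕ) (h₁ s : ℤ) (A : ℝ) :
    ((s : ℝ) / h₁ + A / ((h₁ : ℝ) * ((q * (r + 1) : ℕ) : ℝ))) =
      (s : ℝ) / h₁ + (A / ((h₁ : ℝ) * (r + 1))) * ((q : ℝ))⁻¹ := by
  have h : (h₁ : ℝ) * ((q : ℝ) * ((r : ℝ) + 1)) = ((h₁ : ℝ) * ((r : ℝ) + 1)) * (q : ℝ) := by ring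
  rw [Nat.cast_mul, Nat.cast_succ, h, ← div_div, div_eq_mul_inv (A / _) (q : ℝ)]

/-- **The cell's dual point in `(X₁/q, σ + X₂/q)` form.** [folklore] -/
theorem fourier2_boxWeight_cell_eq (q d₁ d₂ α β r : ℕ) (i : ℕ × ℕ) (h₁ s : ℤ) (A : ℝ) :
    fourier2 (boxWeight q d₁ d₂ α β (r + 1) i) ((h₁ : ℝ) / ((q * (r + 1) : ℕ) : ℝ))
        ((s : ℝ) / h₁ + A / ((h₁ : ℝ) * ((q * (r + 1) : ℕ) : ℝ))) =
      fourier2 (boxWeight q d₁ d₂ α β (r + 1) i) (((h₁ : ℝ) / (r + 1)) * ((q : ℝ))⁻¹)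
        ((s : ℝ) / h₁ + (A / ((h₁ : ℝ) * (r + 1))) * ((q : ℝ))⁻¹) := by
  rw [dualPoint_fst_eq, dualPoint_snd_eq]

/-- **A switched cell's level sum in level-factor form.** For a finite set `S` of levels `q ≥ 1`, `1 ≤ l, m`, divisors
`d₁ ∣ l`, `d₂ ∣ m`, a Petersson index `r`, a box `i`, a switched pair `(h₁, s)`, the product `A : ℝ` of the frequencies
(any real), and complex level weights `c_q`:
`Σ_{q∈S} c_q·Φ̂_{q,d₁,d₂,l/d₁,m/d₂,r+1,i}(h₁/(q(r+1)), s/h₁ + A/(h₁q(r+1))) = ∫dt₁∫dt₂ K(t)·Σ_{q∈S} c_q Ψ_t(q⁻¹)`.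
[cite: KowalskiMichelVanderKam2000, §6 p. 19, (21)–(23) p. 12 — derivation] -/
theorem sum_mul_fourier2_boxWeight_cell_eq {l m d₁ d₂ : ℕ} (hl : 1 ≤ l) (hm : 1 ≤ m) (hd₁ : d₁ ∣ l) (hd₂ : d₂ ∣ m)
    (r : ℕ) (i : ℕ × ℕ) (h₁ s : ℤ) (A : ℝ) (S : Finset ℕ) (hS : ∀ q ∈ S, q ≠ 0) (c : ℕ → ℂ) :
    ∑ q ∈ S, c q * fourier2 (boxWeight q d₁ d₂ (l / d₁) (m / d₂) (r + 1) i) ((h₁ : ℝ) / ((q * (r + 1) : ℕ) : ℝ))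
        ((s : ℝ) / h₁ + A / ((h₁ : ℝ) * ((q * (r + 1) : ℕ) : ℝ))) =
      ∫ t₁, ∫ t₂, (((dyadicBump (t₁ / 2 ^ i.1) * dyadicBump (t₂ / 2 ^ i.2) *
            (((d₁ : ℝ) * t₁ * ((d₂ : ℝ) * t₂)) ^ (-(1 / 2 : ℝ)) * (((r + 1 : ℕ) : ℝ))⁻¹) : ℝ) : ℂ) *
              ker t₂ ((s : ℝ) / h₁)) *
        ∑ q ∈ S, c q *
          (((cutoffW ((4 * π ^ 2 * ((d₁ : ℝ) * t₁ * ((d₂ : ℝ) * t₂))) * ((q : ℝ))⁻¹) : ℝ) : ℂ) *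
            ((besselJ 1 ((4 * π * Real.sqrt (((l / d₁ : ℕ) : ℝ) * t₁ * (((m / d₂ : ℕ) : ℝ) * t₂)) / ((r + 1 : ℕ) : ℝ)) *
                ((q : ℝ))⁻¹) : ℝ) : ℂ) *
              Complex.exp (((-2 * π * (t₁ * ((h₁ : ℝ) / (r + 1)) + t₂ * (A / ((h₁ : ℝ) * (r + 1)))) *
                ((q : ℝ))⁻¹ : ℝ) : ℂ) * I)) := by
  have hd₁1 : 1 ≤ d₁ := Nat.pos_of_dvd_of_pos hd₁ hl
  have hd₂1 : 1 ≤ d₂ := Nat.pos_of_dvd_of_pos hd₂ hm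
  have hα : 1 ≤ l / d₁ := Nat.div_pos (Nat.le_of_dvd hl hd₁) hd₁1
  have hβ : 1 ≤ m / d₂ := Nat.div_pos (Nat.le_of_dvd hm hd₂) hd₂1
  have h1 : ∀ q ∈ S, c q * fourier2 (boxWeight q d₁ d₂ (l / d₁) (m / d₂) (r + 1) i)
      ((h₁ : ℝ) / ((q * (r + 1) : ℕ) : ℝ)) ((s : ℝ) / h₁ + A / ((h₁ : ℝ) * ((q * (r + 1) : ℕ) : ℝ))) =
      c q * fourier2 (boxWeight q d₁ d₂ (l / d₁) (m / d₂) (r + 1) i) (((h₁ : ℝ) / (r + 1)) * ((q : ℝ))⁻¹)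
        ((s : ℝ) / h₁ + (A / ((h₁ : ℝ) * (r + 1))) * ((q : ℝ))⁻¹) := fun q _ => by
    rw [fourier2_boxWeight_cell_eq]
  rw [Finset.sum_congr rfl h1, sum_mul_fourier2_boxWeight_eq hd₁1 hd₂1 hα hβ i _ _ _ S hS c]

end Summit.Parity.GeneralizedHardyLittlewood.Theorems.BeyondDiagonalBeatsQuarter.LevelSeparation

end
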